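import Summits.CriticalPhenomena.PercolationContinuityZ3.Theorems.PercNearOneGluingNoHeavyLowerTailCutAntichain
import Literature.Probability.Percolation.PercolationProofs
import HarnessLib

/-!
# `NoHeavyLowerTail` (stmt-CriticalPhenomena-4575) — corner programme, layer 2:
# support boundaries of open clusters, closed sets, and the cut bookkeeping of the corner theorem

Combinatorial half of the corner dictionary (coupling seat, memo `A5-COUPLING-gen2.md` §4.6; layer 1 is
`…CornerAsymptotics`).  For a finite vertex type `V`, a support `E : Finset (Sym2 V)` (the pairs that may be open)
and a configuration `↑S`, `S ⊆ E` (the open pairs):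

* `Corner.Crosses U e` / `Corner.bdry E U` — the support pairs with exactly one endpoint in the vertex set `U`;
* `Corner.clus ω x` — the open cluster of `x` as a `Finset`;
* `Corner.bdry_clus_subset_sdiff` — every support pair on the boundary of an open cluster is CLOSED
  (`bdry E (clus ↑S x) ⊆ E \ S`), hence a configuration separating `x` from `y` has at least
  `min-cut(x,y)` closed pairs (`card_sdiff_ge_of_not_reachable`);
* `Corner.reachable_mem_of_no_open_crossing` — if no open pair crosses `U`, open paths from `U` stay in `U`; in
  particular the configuration `E \ bdry E U` separates `U` from its complement (`not_reachable_of_sdiff_bdry`);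
* `Corner.card_bdry_eq_adj` — the bridge to the multigraph cut count `adj⟦c; U, Uᶜ⟧` of `…CutAntichain`
  (with `c = Corner.mult E`), and the derived complement symmetry / submodularity of `|bdry E ·|`;
* `Corner.reachable_target_of_min_realizer` — the "both sides of a minimum cut are connected" step of the corner
  reading of the tripod exchange: if `E \ S` is exactly the boundary of the cluster of `t₂`, of minimum size `m ≥ 1`
  among `t₂`–`b` cuts, and `t₁ ∉ C(t₂)` is a vertex all of whose `b`-cuts have size `≥ m`, then `t₁ ↔ b` in `↑S`.

Pure finite combinatorics; nothing here asserts anything about the crux. [folklore] throughout (cut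
sub/posimodularity: Korte–Vygen, Lemma 2.1).
-/

noncomputable section

namespace Summit.CriticalPhenomena.PercolationContinuityZ3.Theorems

open Finset
open Literature.Probability.Percolation

namespace Corner

open scoped Classical

variable {V : Type*} [Fintype V] [DecidableEq V]

/-! ### Crossing pairs, boundaries, clusters -/

/-- The PREDICATE "the pair `e` CROSSES the vertex set `U`": `e = s(u,v)` with `u ∈ U`, `v ∉ U` (a predicate with
parameters, not a statement). [folklore] -/
def Crosses (U : Finset V) (e : Sym2 V) : Prop := ∃ u ∈ U, ∃ v ∉ U, e = s(u, v)

/-- The support boundary of `U`: support pairs crossing `U`. [folklore] -/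
def bdry (E : Finset (Sym2 V)) (U : Finset V) : Finset (Sym2 V) := E.filter (Crosses U)

/-- The open cluster of `x` in the configuration `ω`, as a `Finset`. [folklore] -/
def clus (ω : BondConfig V) (x : V) : Finset V := Finset.univ.filter fun y => (openGraph ω).Reachable x y

/-- Membership in the cluster is reachability. [folklore] -/
theorem mem_clus {ω : BondConfig V} {x y : V} : y ∈ clus ω x ↔ (openGraph ω).Reachable x y := by
  simp [clus]

omit [Fintype V] [DecidableEq V] in
/-- The boundary lies in the support. [folklore] -/
theorem bdry_subset (E : Finset (Sym2 V)) (U : Finset V) : bdry E U ⊆ E := Finset.filter_subset _ _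

omit [Fintype V] [DecidableEq V] in
/-- Membership in the boundary. [folklore] -/
theorem mem_bdry {E : Finset (Sym2 V)} {U : Finset V} {e : Sym2 V} :
    e ∈ bdry E U ↔ e ∈ E ∧ Crosses U e := Finset.mem_filter

/-- Crossing is symmetric under complementation. [folklore] -/
theorem crosses_compl {U : Finset V} {e : Sym2 V} : Crosses Uᶜ e ↔ Crosses U e := by
  constructor
  · rintro ⟨u, hu, v, hv, rfl⟩
    rw [Finset.mem_compl] at hu
    rw [Finset.mem_compl, not_not] at hv
    exact ⟨v, hv, u, hu, Sym2.eq_swap⟩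
  · rintro ⟨u, hu, v, hv, rfl⟩
    exact ⟨v, Finset.mem_compl.2 hv, u, fun h => (Finset.mem_compl.1 h) hu, Sym2.eq_swap⟩

/-- The boundary is symmetric under complementation. [folklore] -/
theorem bdry_compl (E : Finset (Sym2 V)) (U : Finset V) : bdry E Uᶜ = bdry E U := by
  ext e; simp only [mem_bdry, crosses_compl]

omit [Fintype V] [DecidableEq V] in
/-- A crossing pair is not a loop and has exactly one endpoint in `U`: membership form. [folklore] -/
theorem crosses_mk_iff {U : Finset V} {u v : V} : Crosses U s(u, v) ↔ (u ∈ U ∧ v ∉ U) ∨ (v ∈ U ∧ u ∉ U) := by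
  constructor
  · rintro ⟨a, ha, c, hc, h⟩
    rcases Sym2.eq_iff.1 h with ⟨rfl, rfl⟩ | ⟨rfl, rfl⟩
    · exact Or.inl ⟨ha, hc⟩
    · exact Or.inr ⟨ha, hc⟩
  · rintro (⟨hu, hv⟩ | ⟨hv, hu⟩)
    · exact ⟨u, hu, v, hv, rfl⟩
    · exact ⟨v, hv, u, hu, Sym2.eq_swap⟩

/-! ### Closed boundaries of clusters -/

/-- **The boundary of an open cluster is closed**: for `S ⊆ E`, every support pair crossing `C(x)` lies in
`E \ S`. [folklore] -/
theorem bdry_clus_subset_sdiff {E S : Finset (Sym2 V)} (x : V) :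
    bdry E (clus (↑S : Set (Sym2 V)) x) ⊆ E \ S := by
  intro e he
  rw [mem_bdry] at he
  obtain ⟨heE, u, hu, v, hv, rfl⟩ := he
  rw [Finset.mem_sdiff]
  refine ⟨heE, fun heS => hv ?_⟩
  have huv : u ≠ v := by rintro rfl; exact hv hu
  rw [mem_clus] at hu ⊢
  have hadj : (openGraph (↑S : Set (Sym2 V))).Adj u v := (openGraph_adj _ u v).2 ⟨by exact_mod_cast heS, huv⟩
  exact hu.trans hadj.reachable

/-- If `y` is not reachable from `x` in `↑S` (`S ⊆ E`), then at least `|bdry E C(x)|` support pairs are closed. [folklore] -/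
theorem card_bdry_clus_le_card_sdiff {E S : Finset (Sym2 V)} (x : V) :
    (bdry E (clus (↑S : Set (Sym2 V)) x)).card ≤ (E \ S).card :=
  Finset.card_le_card (bdry_clus_subset_sdiff x)

/-- If exactly `|bdry E C(x)|` pairs are closed then the closed set IS the boundary of `C(x)`. [folklore] -/
theorem sdiff_eq_bdry_clus_of_card_le {E S : Finset (Sym2 V)} (x : V)
    (h : (E \ S).card ≤ (bdry E (clus (↑S : Set (Sym2 V)) x)).card) :
    E \ S = bdry E (clus (↑S : Set (Sym2 V)) x) :=
  (Finset.eq_of_subset_of_card_le (bdry_clus_subset_sdiff x) h).symm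

/-! ### Open paths cannot cross a set without an open crossing pair -/

omit [Fintype V] in
/-- If no open pair crosses `U`, open walks from `U` stay in `U`. [folklore] -/
theorem reachable_mem_of_no_open_crossing {ω : BondConfig V} {U : Finset V}
    (hU : ∀ e ∈ ω, ¬ Crosses U e) {x y : V} (hxy : (openGraph ω).Reachable x y) (hx : x ∈ U) : y ∈ U := by
  obtain ⟨p⟩ := hxy
  induction p with
  | nil => exact hx
  | cons hadj p ih =>
    rename_i a c d
    apply ih
    by_contra hc
    have h := (openGraph_adj ω a c).1 hadj
    exact hU _ h.1 ⟨a, hx, c, hc, rfl⟩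

omit [Fintype V] in
/-- In the configuration `E \ bdry E U` no open pair crosses `U`. [folklore] -/
theorem no_open_crossing_sdiff_bdry (E : Finset (Sym2 V)) (U : Finset V) :
    ∀ e ∈ (↑(E \ bdry E U) : Set (Sym2 V)), ¬ Crosses U e := by
  intro e he hcr
  have he' : e ∈ E \ bdry E U := by exact_mod_cast he
  rw [Finset.mem_sdiff] at he'
  exact he'.2 (mem_bdry.2 ⟨he'.1, hcr⟩)

/-- In the configuration `E \ bdry E U`, clusters of points of `U` stay inside `U`. [folklore] -/
theorem clus_sdiff_bdry_subset (E : Finset (Sym2 V)) (U : Finset V) {x : V} (hx : x ∈ U) :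
    clus (↑(E \ bdry E U) : Set (Sym2 V)) x ⊆ U := fun _ hy =>
  reachable_mem_of_no_open_crossing (no_open_crossing_sdiff_bdry E U) (mem_clus.1 hy) hx

omit [Fintype V] in
/-- In the configuration `E \ bdry E U`, a point of `U` is not joined to a point outside `U`. [folklore] -/
theorem not_reachable_of_sdiff_bdry (E : Finset (Sym2 V)) (U : Finset V) {x y : V} (hx : x ∈ U) (hy : y ∉ U) :
    ¬ (openGraph (↑(E \ bdry E U) : Set (Sym2 V))).Reachable x y := fun h =>
  hy (reachable_mem_of_no_open_crossing (no_open_crossing_sdiff_bdry E U) h hx)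

omit [Fintype V] in
/-- `|E \ (E \ bdry E U)| = |bdry E U|`. [folklore] -/
theorem card_sdiff_sdiff_bdry (E : Finset (Sym2 V)) (U : Finset V) :
    (E \ (E \ bdry E U)).card = (bdry E U).card := by
  rw [Finset.sdiff_sdiff_eq_self (bdry_subset E U)]

/-! ### Vertex min-cut bounds from the order of a disconnection event -/

omit [Fintype V] in
/-- If every open set `S ⊆ E` with `x ↮ y` has at least `m` closed support pairs, then every vertex set containing
`x` and not `y` has at least `m` boundary pairs. [folklore] -/
theorem le_card_bdry_of_order {E : Finset (Sym2 V)} {x y : V} {m : ℕ}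
    (hm : ∀ S ∈ E.powerset, (↑S : Set (Sym2 V)) ∈ (openConn x y)ᶜ → m ≤ (E \ S).card)
    {U : Finset V} (hx : x ∈ U) (hy : y ∉ U) : m ≤ (bdry E U).card := by
  have h := hm (E \ bdry E U) (Finset.mem_powerset.2 Finset.sdiff_subset)
    (not_reachable_of_sdiff_bdry E U hx hy)
  rwa [card_sdiff_sdiff_bdry] at h

/-! ### Bridge to the ordered adjacency count of `…CutAntichain` -/

omit [Fintype V] in
/-- The multiplicity function of the support: `1` on distinct support pairs, `0` otherwise. [folklore] -/
def mult (E : Finset (Sym2 V)) (u v : V) : ℕ := if u ≠ v ∧ s(u, v) ∈ E then 1 else 0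

omit [Fintype V] in
/-- `mult` is symmetric. [folklore] -/
theorem mult_comm (E : Finset (Sym2 V)) (u v : V) : mult E u v = mult E v u := by
  unfold mult
  simp only [ne_comm (a := u), Sym2.eq_swap (a := u)]

/-- **Bridge**: the number of boundary pairs of `U` is the ordered adjacency count `adj⟦mult E; U, Uᶜ⟧`
(each crossing pair is counted once, oriented from `U` outwards). [folklore] -/
theorem card_bdry_eq_adj (E : Finset (Sym2 V)) (U : Finset V) :
    ((bdry E U).card : ℤ) = ∑ u, ∑ v, if u ∈ U ∧ v ∈ Uᶜ then (↑(mult E u v) : ℤ) else 0 := by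
  -- ordered pairs (u, v) with u ∈ U, v ∉ U, s(u,v) ∈ E, in bijection with bdry E U
  have hsum : (∑ u, ∑ v, if u ∈ U ∧ v ∈ Uᶜ then (↑(mult E u v) : ℤ) else 0) =
      ∑ p ∈ (Finset.univ : Finset (V × V)).filter (fun p => p.1 ∈ U ∧ p.2 ∉ U ∧ s(p.1, p.2) ∈ E), (1 : ℤ) := by
    rw [← Finset.sum_product' (f := fun u v => if u ∈ U ∧ v ∈ Uᶜ then (↑(mult E u v) : ℤ) else 0),
      Finset.univ_product_univ, Finset.sum_filter]
    refine Finset.sum_congr rfl fun p _ => ?_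
    unfold mult
    by_cases h1 : p.1 ∈ U <;> by_cases h2 : p.2 ∈ U <;> by_cases h3 : s(p.1, p.2) ∈ E <;>
      simp [h1, h2, h3, Finset.mem_compl]
    intro h12; rw [h12] at h1; exact h2 h1
  rw [hsum, Finset.sum_const, nsmul_eq_mul, mul_one]
  norm_cast
  refine (Finset.card_bij (fun p _ => s(p.1, p.2)) ?_ ?_ ?_).symm
  · intro p hp
    rw [Finset.mem_filter] at hp
    exact mem_bdry.2 ⟨hp.2.2.2, p.1, hp.2.1, p.2, hp.2.2.1, rfl⟩
  · intro p hp q hq hpq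
    rw [Finset.mem_filter] at hp hq
    rcases Sym2.eq_iff.1 hpq with ⟨h1, h2⟩ | ⟨h1, h2⟩
    · exact Prod.ext h1 h2
    · exact absurd (h1 ▸ hp.2.1) hq.2.2.1
  · intro e he
    rw [mem_bdry] at he
    obtain ⟨heE, u, hu, v, hv, rfl⟩ := he
    exact ⟨(u, v), Finset.mem_filter.2 ⟨Finset.mem_univ _, hu, hv, heE⟩, rfl⟩

/-- Complement symmetry of the boundary count, in `adj` form. [folklore] -/
theorem adj_compl_eq (E : Finset (Sym2 V)) (U : Finset V) :
    (∑ u, ∑ v, if u ∈ Uᶜ ∧ v ∈ Uᶜᶜ then (↑(mult E u v) : ℤ) else 0) =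
      ∑ u, ∑ v, if u ∈ U ∧ v ∈ Uᶜ then (↑(mult E u v) : ℤ) else 0 := by
  rw [← card_bdry_eq_adj, ← card_bdry_eq_adj, bdry_compl]

/-- **Submodularity of the boundary count**: `|bdry(A ∩ B)| + |bdry(A ∪ B)| ≤ |bdry A| + |bdry B|`
(posimodularity of `…CutAntichain` applied to `A` and `Bᶜ`). [folklore] -/
theorem card_bdry_inter_add_union_le (E : Finset (Sym2 V)) (A B : Finset V) :
    (bdry E (A ∩ B)).card + (bdry E (A ∪ B)).card ≤ (bdry E A).card + (bdry E B).card := by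
  have h := CutAntichain.cut_sdiff_add (mult E) (mult_comm E) A Bᶜ
  have e1 : A \ Bᶜ = A ∩ B := by ext; simp
  have e2 : Bᶜ \ A = (A ∪ B)ᶜ := by ext; simp [and_comm]
  rw [e1, e2, adj_compl_eq E (A ∪ B), adj_compl_eq E B, ← card_bdry_eq_adj, ← card_bdry_eq_adj,
    ← card_bdry_eq_adj, ← card_bdry_eq_adj] at h
  have hnn := CutAntichain.adj_nonneg (mult E) (A ∩ Bᶜ) (A ∪ Bᶜ)ᶜ
  omega

omit [Fintype V] in
/-- The empty-boundary set: if `|bdry E U| = 0` then no support pair crosses `U`, so no open path of any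
configuration supported in `E` leaves `U`. [folklore] -/
theorem reachable_mem_of_card_bdry_eq_zero {E S : Finset (Sym2 V)} (hS : S ⊆ E) {U : Finset V}
    (hU : (bdry E U).card = 0) {x y : V} (hxy : (openGraph (↑S : Set (Sym2 V))).Reachable x y) (hx : x ∈ U) :
    y ∈ U := by
  refine reachable_mem_of_no_open_crossing (fun e he hcr => ?_) hxy hx
  have he' : e ∈ S := by exact_mod_cast he
  have : e ∈ bdry E U := mem_bdry.2 ⟨hS he', hcr⟩
  rw [Finset.card_eq_zero] at hU
  simp [hU] at this

/-! ### Both sides of a minimum cut are connected: the `t₁ ↔ b` step of the corner tripod -/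

/-- Clusters of non-joined points are disjoint. [folklore] -/
theorem disjoint_clus_of_not_reachable {ω : BondConfig V} {x y : V} (h : ¬ (openGraph ω).Reachable x y) :
    Disjoint (clus ω x) (clus ω y) := by
  rw [Finset.disjoint_left]
  intro z hzx hzy
  exact h ((mem_clus.1 hzx).trans (mem_clus.1 hzy).symm)

/-- **Connected sides of a minimum realizer.** Let `S ⊆ E` be such that the closed set `E \ S` is exactly the
boundary of `U = C(t₂)`, of size `m ≥ 1`, with `b ∉ U`; assume every vertex set containing `t₂` (resp. `t₁`) but
not `b` has at least `m` boundary pairs, and `t₁ ∉ U`. Then `t₁ ↔ b` in `↑S`. [folklore] -/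
theorem reachable_target_of_min_realizer {E S : Finset (Sym2 V)} {t₁ t₂ b : V} {m : ℕ} (hm : 1 ≤ m)
    (hreal : E \ S = bdry E (clus (↑S : Set (Sym2 V)) t₂))
    (hcard : (bdry E (clus (↑S : Set (Sym2 V)) t₂)).card = m)
    (hb : b ∉ clus (↑S : Set (Sym2 V)) t₂) (ht₁ : t₁ ∉ clus (↑S : Set (Sym2 V)) t₂)
    (hmin₂ : ∀ W : Finset V, t₂ ∈ W → b ∉ W → m ≤ (bdry E W).card)
    (hmin₁ : ∀ W : Finset V, t₁ ∈ W → b ∉ W → m ≤ (bdry E W).card) :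
    (openGraph (↑S : Set (Sym2 V))).Reachable t₁ b := by
  set ω : Set (Sym2 V) := (↑S : Set (Sym2 V)) with hω
  set U := clus ω t₂ with hU
  set W := clus ω b with hW
  -- the complement of W is a t₂-b cut whose boundary lies in the closed set, hence equals bdry U
  have hWsub : bdry E Wᶜ ⊆ bdry E U := by
    rw [bdry_compl, ← hreal]; exact bdry_clus_subset_sdiff b
  have ht₂W : t₂ ∈ Wᶜ := by
    rw [Finset.mem_compl, hW, mem_clus]
    exact fun h => hb (mem_clus.2 h.symm)
  have hbW : b ∉ Wᶜ := by rw [Finset.mem_compl, not_not, hW, mem_clus]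
  have hWeq : bdry E Wᶜ = bdry E U :=
    Finset.eq_of_subset_of_card_le hWsub (by rw [hcard]; exact hmin₂ Wᶜ ht₂W hbW)
  by_contra ht₁b
  -- Y = C(t₁) is a t₁-b cut with boundary inside the closed set: equal to bdry U as well
  set Y := clus ω t₁ with hY
  have hYsub : bdry E Y ⊆ bdry E U := by rw [← hreal]; exact bdry_clus_subset_sdiff t₁
  have ht₁Y : t₁ ∈ Y := mem_clus.2 SimpleGraph.Reachable.rfl
  have hbY : b ∉ Y := fun h => ht₁b (mem_clus.1 h)
  have hYeq : bdry E Y = bdry E U :=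
    Finset.eq_of_subset_of_card_le hYsub (by rw [hcard]; exact hmin₁ Y ht₁Y hbY)
  -- pick a boundary pair of U (m ≥ 1) and chase its endpoints
  have hne : (bdry E U).Nonempty := by
    rw [← Finset.card_pos, hcard]; exact hm
  obtain ⟨e, he⟩ := hne
  obtain ⟨-, u, hu, v, hv, rfl⟩ := mem_bdry.1 he
  have hYU : Disjoint Y U := disjoint_clus_of_not_reachable fun h => ht₁ (mem_clus.2 h.symm)
  have hUW : Disjoint U W := disjoint_clus_of_not_reachable fun h => hb (mem_clus.2 h)
  have hYW : Disjoint Y W := disjoint_clus_of_not_reachable ht₁b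
  -- e ∈ bdry Y: since u ∈ U is not in Y, v ∈ Y
  have heY : s(u, v) ∈ bdry E Y := hYeq ▸ he
  have hvY : v ∈ Y := by
    rcases crosses_mk_iff.1 (mem_bdry.1 heY).2 with ⟨huY, -⟩ | ⟨hvY, -⟩
    · exact absurd hu (Finset.disjoint_left.1 hYU huY)
    · exact hvY
  -- e ∈ bdry Wᶜ: since u ∈ U is not in W, v ∈ W
  have heW : s(u, v) ∈ bdry E Wᶜ := hWeq ▸ he
  rw [bdry_compl] at heW
  have hvW : v ∈ W := by
    rcases crosses_mk_iff.1 (mem_bdry.1 heW).2 with ⟨huW, -⟩ | ⟨hvW, -⟩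
    · exact absurd huW (Finset.disjoint_left.1 hUW hu)
    · exact hvW
  exact Finset.disjoint_left.1 hYW hvY hvW

end Corner

end Summit.CriticalPhenomena.PercolationContinuityZ3.Theorems

end
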